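import Literature.MathematicalPhysics.QuantumFieldTheory.Balaban1983to89.Node00.Carriers2
import Literature.MathematicalPhysics.QuantumFieldTheory.Balaban1983to89.UnitaryModel

/-!
# NODE 00 (YM-PLAN Track A) — SATISFIABILITY OF THE STAGED WORLD-OF-RECORD PREDICATES: `IsWorldOfRecord₁`, `IsWorldOfRecord₁OL` and
# `IsWorldOfRecord₂` each hold at SOME binding world (type-level sanity: the node theorems «at every world of record» do not quantify
# over an empty class)

NODE 00 CELL FILE (seat `pub-ymgap-node00-def`, g5, 2026-08-24; report NODE00-SCOPING.md §3 F3 ∕ §5 Q-N00-6).  WAVE 3 (imports `Node00Carriers2`, hence the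
root; and `UnitaryModel` for a gauge group carrying `GaugeGroup ∕ MeasurableSpace ∕ HaarData` instances); theorems only; count-neutral; NOT proposed (R296).

HONEST FRAMING — READ FIRST.  The node theorems of the root (`b4_main_of_isWorldOfRecord₁`, …) are universally quantified over binding worlds
`w : DagBinding.WorldP` satisfying a staged predicate.  Such a theorem would be worthless if NO world satisfied the predicate.  The root proves
satisfiability RELATIVE to given data (`isWorldOfRecord₁_withUp`: re-binding ANY world over ANY bundles `X Y Z V W`); this file closes the loop
ABSOLUTELY: the carrier-bundle types `PrintedCarriersR`, `PrintedCarriers9X`, `PrintedCarriers11`, `PrintedCarriers14R`, `PrintedCarriers15` and the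
world type `WorldP` are INHABITED (§1), hence worlds of record of every stage exist (§2).  THE WITNESSES OF §1 ARE DEGENERATE — empty index types for
every family, zero constants, the identity as renormalization operation, a trivial construction — and are NOT objects of record, NOT placeholders
offered for any node or datum, and are never named as definitions (they live inside `Nonempty` proofs only).  At the witness worlds of §2 the PINNED
groups are the genuine lineage families (`carriers₁ ∕ carriers₁OL ∕ carriers₂` at an admissible `θ` with `D = 4`), everything else is degenerate —
which is exactly what «Stage s» means (root §3: the un-pinned bundles are arbitrary until their stage).  Nothing of Bałaban's is asserted; one finite
T⁴ programme, NOT continuum ∕ infinite volume ∕ OS ∕ mass gap ∕ Clay.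
-/

noncomputable section

namespace Literature.MathematicalPhysics.QuantumFieldTheory.Balaban1983to89.Node00

open DagBinding DagDischargedII

/-! ## §1. The bundle types and the world type are inhabited (degenerate witnesses; see the header) -/

/-- A `Params` record (`d = 1`, `L = 3`, `m = 0`, `K = 1`) — used only to type the degenerate witnesses below. [cite: Balaban1987RG1, (0.1) p.251 (d, L, m, K) — bookkeeping] -/
theorem nonempty_params : Nonempty Params :=
  ⟨{ d := 1, L := 3, m := 0, K := 1, hd := le_rfl, hL := ⟨⟨1, rfl⟩, by norm_num⟩ }⟩

/-- `PrintedCarriersR` is inhabited (DEGENERATE witness: every family over the empty index type, zero constants; NOT objects of record).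
[cite: Balaban1983RegularityDecay, Theorem p.573; Balaban1988RG2Cluster, Lemmas 1–3 (the bundle's dictionary) — bookkeeping only] -/
theorem nonempty_printedCarriersR : Nonempty PrintedCarriersR :=
  ⟨{ I4E := PEmpty, I4U := PEmpty, I4F := PEmpty, famE := (fun i => nomatch i), famU := (fun i => nomatch i), famF := (fun i => nomatch i),
     d4 := 0, N4 := 0,
     I5 := PEmpty, fam5 := (fun i => nomatch i), forms5 := (fun i => nomatch i),
     D6 := { I := PEmpty, d := 0, L := 0, δ₀ := 0, geo := (fun i => nomatch i), Gp := (fun i => nomatch i), Cinv := (fun i => nomatch i),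
             G := (fun i => nomatch i), Qinv := (fun i => nomatch i), H := (fun i => nomatch i), J := PEmpty, tree := (fun j => nomatch j),
             K := PEmpty, loc := (fun k => nomatch k) },
     I7a := PEmpty, I7b := PEmpty, I7c := PEmpty, I7d := PEmpty, I7e := PEmpty, L7 := 0, c₂ := 0, C₀ := 0, c₂' := 0,
     one7 := (fun i => nomatch i), kst7 := (fun i => nomatch i), kexp7 := (fun i => nomatch i), gd7 := (fun i => nomatch i),
     gone7 := (fun i => nomatch i),
     I8a := PEmpty, I8b := PEmpty, I8c := PEmpty, I8d := PEmpty, d8 := 0, L8 := 0, C₂ := 0, B₁' := 0, B₀' := 0, B₁ := 0, B₂ := 0, c₁ := 0,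
     inp8 := { B₀ := 1, B₀' := 1, B₀_pos := one_pos, B₀'_pos := one_pos }, B₀β := 0,
     loc8 := (fun i => nomatch i), fam8 := (fun i => nomatch i), lan8 := (fun i => nomatch i), cub8 := (fun i => nomatch i),
     toAxial8 := (fun i => nomatch i),
     I10 := PEmpty, runs10 := (fun i => nomatch i),
     F12 := { CfgU := PUnit, CfgA := PUnit, CfgB := PUnit, CfgUJ := PUnit, Uprime := fun _ _ => ∅, A331 := ∅, normB := fun _ => 0,
              Ucj := fun _ _ => ∅, comp := fun _ _ _ _ => PUnit.unit, analyticOn := fun _ _ _ => True },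
     c12 := { B₃ := 0, O₁ := 0, M := 0, L := 0, β₀ := 0, β := 0, α₀ := 0, α₁ := 0, α₂ := 0, α₃ := 0 },
     S13 := { Dk := { Dom := PEmpty, dj := (fun x => nomatch x), dj_nonneg := (fun x => nomatch x) },
              Dk1 := { Dom := PEmpty, dj := (fun x => nomatch x), dj_nonneg := (fun x => nomatch x) },
              volk := (fun x => nomatch x), Φ := PUnit, Bond := PEmpty, sp1 := (fun x => nomatch x), sp2 := (fun x => nomatch x),
              Bv := (fun _ b => nomatch b), Vp := (fun x => nomatch x), V := (fun x => nomatch x), Q := (fun x => nomatch x),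
              Vpp := (fun x => nomatch x), H := (fun x => nomatch x), Ek1 := (fun x => nomatch x), Elog := (fun x => nomatch x),
              Analytic := fun _ _ => True, GaugeInv := fun _ => True, Repr17 := True, Restr := True },
     c13 := { L := 3, q := 0, M := 0, κ := 0, κ₁ := 0, δ := 0, δ₀ := 0, E₀ := 0, ε₁ := 0, C₁ := 0, C₂ := 0, C₃ := 0, α₀ := 0, α₁ := 0,
              α₄ := 0, α₅ := 0, α₆ := 0, γ₂ := 0, γ := 0, A₁ := 0, A₂ := 0 },
     C140 := (fun i => nomatch i), InR := (fun i => nomatch i), proj140 := (fun i => nomatch i) }⟩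

/-- `PrintedCarriers9X` is inhabited (DEGENERATE: empty index). [cite: Balaban1985BackgroundPropagators, Thms 3.1–3.15 (the bundle's dictionary) — bookkeeping only] -/
theorem nonempty_printedCarriers9X : Nonempty PrintedCarriers9X :=
  ⟨{ I9 := PEmpty, d9 := 0, c35 := 0, geo9 := (fun i => nomatch i), bg9 := (fun i => nomatch i), InCube := (fun i => nomatch i),
     Gp := (fun i => nomatch i), GA := (fun i => nomatch i), Cinv := (fun i => nomatch i), IsAnalyticExt := (fun i => nomatch i),
     E37 := (fun i => nomatch i), EK39 := (fun i => nomatch i), E310 := (fun i => nomatch i), PosDef := (fun i => nomatch i),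
     GD := (fun i => nomatch i), G₁ := (fun i => nomatch i), H := (fun i => nomatch i), H₁ := (fun i => nomatch i),
     HasRWExp := (fun i => nomatch i), HasRWExpH := (fun i => nomatch i), PosDefK := (fun i => nomatch i), GG := (fun i => nomatch i),
     Kdiff := (fun i => nomatch i), dOmega := (fun i => nomatch i), Ck := (fun i => nomatch i), inΛ := (fun i => nomatch i),
     unitDist := (fun i => nomatch i), GivenBy3185 := (fun i => nomatch i), HasRWExpC := (fun i => nomatch i),
     P349 := (fun i => nomatch i), QGQinv := (fun i => nomatch i), QG1Qinv := (fun i => nomatch i), OmK := (fun i => nomatch i) }⟩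

/-- `PrintedCarriers11` is inhabited (DEGENERATE: empty index, zero constants). [cite: Balaban1985Variational, Thm 1, Props. 2–9 (the bundle's dictionary) — bookkeeping only] -/
theorem nonempty_printedCarriers11 : Nonempty PrintedCarriers11 :=
  ⟨{ I11 := PEmpty, famV := (fun i => nomatch i), famLG := (fun i => nomatch i), famX := (fun i => nomatch i), famAn := (fun i => nomatch i),
     B₀ := 0, B₁ := 0, B₃ := 0, B₅ := 0, C₁ := 0, C₂ := 0, C₃ := 0, c₁ := 0, c1h := 0, c₄ := 0, δ₀ := 0, β₀ := 0 }⟩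

/-- `PrintedCarriers14R` is inhabited (DEGENERATE: gauge group `U(1) ⊂ M₁(ℂ)` with the tree's instances (`UnitaryModel`), the identity as
«renormalization operation», trivially true side conditions). [cite: Balaban1988Convergent, p.244 (the bundle's dictionary) — bookkeeping only] -/
theorem nonempty_printedCarriers14R : Nonempty PrintedCarriers14R := by
  obtain ⟨P⟩ := nonempty_params
  exact ⟨{ P := P, G := ↥(Matrix.unitaryGroup (Fin 1) ℂ), instGG := inferInstance, instMS := inferInstance, instHD := inferInstance,
           K := 0, R := fun _ ρ => ρ, Scorr := fun _ _ => True, S := fun _ _ => True }⟩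

/-- `PrintedCarriers15` is inhabited (DEGENERATE: empty regions ∕ instances ∕ plaquettes, the identity as `R′`, the constant density `1`).
[cite: Balaban1989LargeFieldI, (0.2)–(0.6) p.176, Prop. 1 p.194 (the bundle's dictionary) — bookkeeping only] -/
theorem nonempty_printedCarriers15 : Nonempty PrintedCarriers15 := by
  obtain ⟨P⟩ := nonempty_params
  exact ⟨{ D := { Vsp := PUnit, Reg := PEmpty, instF := inferInstance, Int := fun _ => 0, IntOver := (fun r => nomatch r),
                  Zp := (fun r => nomatch r), Zpp := (fun r => nomatch r), ρ := (fun r => nomatch r) },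
           Zpp := PEmpty, instZ := inferInstance, ρpp := (fun z => nomatch z), Rsum := (fun z => nomatch z),
           LF := { Inst := PEmpty, M := (fun i => nomatch i), Bdry := (fun i => nomatch i), Orbit := (fun i => nomatch i),
                   Regular := (fun i => nomatch i), IsCritical := (fun i => nomatch i), IsMinimum := (fun i => nomatch i),
                   dev := (fun i => nomatch i), AnalyticExt := (fun i => nomatch i) },
           Plaq := PEmpty, dev180 := (fun p => nomatch p), distΛ := (fun p => nomatch p), εk := 0, η := 0, B₃ := 0, B₅ := 0, M := 0, δ := 0,
           C180 := 0, Cfg := PUnit, remaining := fun _ => True, dropped := fun _ => False, P15 := P, j15 := 0,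
           G15 := ↥(Matrix.unitaryGroup (Fin 1) ℂ), instGG15 := inferInstance, instMS15 := inferInstance, instHD15 := inferInstance,
           Rprime := fun ρ => ρ, ρk := fun _ => 1 }⟩

/-- `DagBinding.WorldP` is inhabited (DEGENERATE: a trivial construction — one configuration per step, zero actions, unit densities, all predicates
`True` — unit scalars, all-`True` upstream block).  NOT a construction of record (`w₀.C` is Stage 5). [cite: Balaban1988Convergent, Thm 1 p.262 (the world's dictionary) — bookkeeping only] -/
theorem nonempty_worldP : Nonempty WorldP :=
  ⟨{ C := fun _ =>
       { flow := { g := fun _ => 1, β := fun _ _ => 0 }, Cfg := fun _ => PUnit, dom := fun _ => Set.univ, effAction := fun _ _ => 0,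
         wilsonBG := fun _ _ => 0, Ek := fun _ _ => 0, numSites := fun _ => 1, Repr := fun _ => True, IndAss := fun _ => True,
         ρ := fun _ _ => 1, χ := fun _ _ => 1, Sect2Form := fun _ => True },
     γ := 1, em := fun _ => 0, ep := fun _ => 0, βup := 1, β₀ := 1, β₀_pos := one_pos, b := 1, b_pos := one_pos, L := 2,
     one_lt_L := one_lt_two, gR := 1,
     up := fun _ => { b4 := True, b5 := True, b6 := True, b7 := True, b8 := True, b9 := True, b10 := True, b11 := True, b12 := True,
                      b13 := True, rOperation := True, rBasicStep := True } }⟩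

/-! ## §2. The staged predicates are satisfiable -/

/-- **`IsWorldOfRecord₁` is satisfiable, with `D = 4`**: there is a binding world of record, Stage 1, whose family parameters are admissible with
physical dimension 4 (the root's `exists_admissible` witness; the B4 ∕ B5 groups pinned to the genuine lineage families there, the un-pinned bundles
degenerate). [cite: Balaban1983RegularityDecay, (1.1)–(1.7) pp.572–573; Balaban1984PropagatorsI, Props. 1.1–1.2 pp.33–36 — bookkeeping] -/
theorem exists_isWorldOfRecord₁ :
    ∃ (w : WorldP) (θ : Stage1Params), θ.Admissible ∧ θ.D = 4 ∧
      (∀ P : B12.RunParams, ∃ (X : PrintedCarriersR) (Y : PrintedCarriers9X) (Z : PrintedCarriers11) (V : PrintedCarriers14R)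
        (W : PrintedCarriers15), w.up P = Upstream.ofPrintedAllXPN (carriers₁ θ X) Y Z V W) ∧ IsWorldOfRecord₁ w := by
  obtain ⟨θ, hθ, hD⟩ := Stage1Params.exists_admissible
  obtain ⟨X⟩ := nonempty_printedCarriersR
  obtain ⟨Y⟩ := nonempty_printedCarriers9X
  obtain ⟨Z⟩ := nonempty_printedCarriers11
  obtain ⟨V⟩ := nonempty_printedCarriers14R
  obtain ⟨W⟩ := nonempty_printedCarriers15
  obtain ⟨w⟩ := nonempty_worldP
  exact ⟨WorldP.withUp w fun _ => Upstream.ofPrintedAllXPN (carriers₁ θ X) Y Z V W, θ, hθ, hD, fun _ => ⟨X, Y, Z, V, W, rfl⟩,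
    isWorldOfRecord₁_withUp w θ hθ X Y Z V W⟩

/-- **`IsWorldOfRecord₁OL` (one-level B6 reading) is satisfiable** (one-level parameters `δ₀ = 1`, `m²′ = 0`). [cite: Balaban1984PropagatorsII, (2.1)–(2.2) p.224 — bookkeeping] -/
theorem exists_isWorldOfRecord₁OL : ∃ w : WorldP, IsWorldOfRecord₁OL w := by
  obtain ⟨θ, hθ, -⟩ := Stage1Params.exists_admissible
  obtain ⟨X⟩ := nonempty_printedCarriersR
  obtain ⟨Y⟩ := nonempty_printedCarriers9X
  obtain ⟨Z⟩ := nonempty_printedCarriers11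
  obtain ⟨V⟩ := nonempty_printedCarriers14R
  obtain ⟨W⟩ := nonempty_printedCarriers15
  obtain ⟨w⟩ := nonempty_worldP
  let ν : B6OneLevelParams := { δ₀ := 1, msq := 0, hδ := one_pos, hmsq := le_rfl }
  exact ⟨WorldP.withUp w fun _ => Upstream.ofPrintedAllXPN (carriers₁OL θ ν X) Y Z V W,
    isWorldOfRecord₁OL_of_up θ hθ ν X Y Z V W _ rfl⟩

/-- **`IsWorldOfRecord₂` (Stage 2, + B7 group) is satisfiable**, coefficient algebra `𝔸 = ℂ` (print: `M_N(ℂ)`; `N = 1`). [cite: Balaban1985Averaging, Props. 1–10 pp.26–50 — bookkeeping] -/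
theorem exists_isWorldOfRecord₂ : ∃ w : WorldP, IsWorldOfRecord₂ w := by
  obtain ⟨θ, hθ, -⟩ := Stage1Params.exists_admissible
  obtain ⟨X⟩ := nonempty_printedCarriersR
  obtain ⟨Y⟩ := nonempty_printedCarriers9X
  obtain ⟨Z⟩ := nonempty_printedCarriers11
  obtain ⟨V⟩ := nonempty_printedCarriers14R
  obtain ⟨W⟩ := nonempty_printedCarriers15
  obtain ⟨w⟩ := nonempty_worldP
  let θ₂ : Stage2Params := { θ with 𝔸 := ℂ }
  exact ⟨WorldP.withUp w fun _ => Upstream.ofPrintedAllXPN (carriers₂ θ₂ X) Y Z V W, isWorldOfRecord₂_of_up θ₂ hθ X Y Z V W _ rfl⟩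

/-- **Summary**: worlds of record of every staged kind EXIST (Stage 1 with `D = 4`, the one-level B6 reading, Stage 2) — so none of the node theorems
`b4 ∕ b5 ∕ b6 ∕ b7_main_of_isWorldOfRecord…` quantifies over an empty class. [cite: Balaban1983RegularityDecay, Theorem p.573; Balaban1984PropagatorsI, Props. 1.1–1.2; Balaban1984PropagatorsII, Lemma 2.1 – Cor. 2.8; Balaban1985Averaging, Props. 1–10 — bookkeeping] -/
theorem staged_predicates_satisfiable :
    (∃ w : WorldP, IsWorldOfRecord₁ w) ∧ (∃ w : WorldP, IsWorldOfRecord₁OL w) ∧ (∃ w : WorldP, IsWorldOfRecord₂ w) :=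
  ⟨exists_isWorldOfRecord₁.imp fun _ ⟨_, _, _, _, h⟩ => h, exists_isWorldOfRecord₁OL, exists_isWorldOfRecord₂⟩

end Literature.MathematicalPhysics.QuantumFieldTheory.Balaban1983to89.Node00

end
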